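import Literature.NumberTheory.GaloisRepresentations.DualityLineTwo
import Literature.NumberTheory.GaloisRepresentations.ContinuousCohomologyNineTerm
import Literature.NumberTheory.GaloisRepresentations.CohomologicalDimensionTowerProofs
import Literature.NumberTheory.GaloisRepresentations.FiniteCoefficients
import HarnessLib

/-!
# `H²(G, A) = 0` for a `p`-divisible discrete `p`-primary module with uniformly bounded `H²(G, A[p^k])`
# over a group of `p`-cohomological dimension `≤ 2`

Topic `NumberTheory/GaloisRepresentations`; namespace `Literature.NumberTheory.GaloisRepresentations`.
Theorems only (no definition, no named fact; D-0026).

Let `G` be a profinite group with `cd_p(G) ≤ 2` (`GroupCdLE G p 2`, e.g. the absolute Galois group of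
a `p`-adic field, Serre II §5.3 / tree `LocalFieldCdTwo`) and `A` a discrete `G`-module which is
`p`-primary torsion and `p`-DIVISIBLE (e.g. `E[p^∞]`).  Write `A[p^k]` for its `p^k`-torsion
sub-representation (`ContinuousRep.torsionRep`).  Then:

* `exists_nsmul_eq_of_groupCdLE_two` — **`H²(G, A)` is `p`-divisible**: the short exact sequence
  `0 → A[p] → A →(p) A → 0` and `H³(G, A[p]) = 0` make `H²(p) : H²(G, A) → H²(G, A)` onto
  (`IsSES.exists_map_two_eq_of_subsingleton_three`), and `H²(p) = p · id`;
* `exists_mem_range_cohomologyMap_torsionIncl` — **every class of `H²(G, A)` comes from some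
  `H²(G, A[p^k])`** (a continuous `2`-cocycle on the compact `G × G` takes finitely many values) and is
  killed by that `p^k`;
* `subsingleton_two_of_divisible_of_natCard_le` — **if `#H²(G, A[p^k]) ≤ B` for all `k`, then
  `H²(G, A) = 0`**: for `x = p^m y` with `p^m > B`, the class `y` lies in the image of some
  `H²(G, A[p^k])`, a group of order `≤ B`, so its order `p^j ≤ B < p^m` divides `p^m` and `x = 0`.

For `G = Γ_{K_v}` (`v ∤ ∞`) and `A = E[p^∞]` the bound is `#H²(K_v, E[p^k]) = #E(K_v)[p^k] ≤ #E(K_v)_{tors}`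
(tree `natCard_galoisCohomology_two_torsion_restrictField`, local Tate duality in bidegree `(2,0)` +
Weil pairing), giving `H²(K_v, E[p^∞]) = 0` — the local input of the level-`K` bypass of Greenberg's
Λ-adic `H²` (LNM 1716 §4 Appendix p. 113: "if `η` is nonarchimedean … `H²((F_∞)_η, E[p^∞]) = 0`";
here already over `K_v`).  HONEST FRAMING: generic group cohomology; nothing about any curve or
summit is asserted.

## References
* J.-P. Serre, *Cohomologie galoisienne* (1997), I §3 (cd_p), II §5. [SerreGaloisCohomology1997]
* J. S. Milne, *Arithmetic Duality Theorems* (2006), I Cor. 2.3, §3 (`H²(K, A) = 0` for abelian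
  varieties over local fields, Rem. 3.6/Thm. 3.2 proof). [MilneADT2006]
* R. Greenberg, LNM 1716 (1999), §4 Appendix p. 113. [GreenbergLNM1716]
-/

noncomputable section

open CategoryTheory ContinuousCohomology Function
open _root_.TopRep _root_.Topology

universe u

namespace Literature.NumberTheory.GaloisRepresentations

variable {G : Type u} [Group G] [TopologicalSpace G] [IsTopologicalGroup G] [CompactSpace G] [T2Space G]
variable {A : Type u} [AddCommGroup A] [TopologicalSpace A] [DiscreteTopology A]
variable (τ : ContinuousRep G ℤ A) {p : ℕ} [hp : Fact p.Prime]

omit [IsTopologicalGroup G] [CompactSpace G] [T2Space G] hp in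
/-- `0 → A[p] → A →(g) A → 0` is short exact for any endomorphism `g` acting as multiplication by `p`
on the `p`-divisible module `A`. [folklore] -/
private theorem isSES_torsionIncl_of_hom (g : τ.toTopRep ⟶ τ.toTopRep) (hg : ∀ a : A, g.hom a = p • a)
    (hdiv : ∀ a : A, ∃ b : A, p • b = a) : IsSES (τ.torsionIncl p) g := by
  refine ⟨?_, ?_, ?_, ?_⟩
  · ext a
    change g.hom (a : A) = 0
    rw [hg]
    exact (ContinuousRep.mem_torsionBy_nsmul_iff p).1 a.2
  · exact Subtype.val_injective
  · intro y hy
    rw [hg] at hy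
    exact ⟨⟨y, (ContinuousRep.mem_torsionBy_nsmul_iff p).2 hy⟩, rfl⟩
  · intro a
    obtain ⟨b, hb⟩ := hdiv a
    exact ⟨b, by rw [hg, hb]⟩

omit [TopologicalSpace A] [DiscreteTopology A] hp in
/-- The `p^k`-torsion submodule is `p`-primary. [folklore] -/
private theorem isPrimaryTorsion_torsionBy_pow (k : ℕ) :
    IsPrimaryTorsion p (Submodule.torsionBy ℤ A ((p ^ k : ℕ) : ℤ)) := fun a =>
  ⟨k, Subtype.ext (by
    rw [Submodule.coe_smul_of_tower, Submodule.coe_zero]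
    exact (ContinuousRep.mem_torsionBy_nsmul_iff (p ^ k)).1 a.2)⟩

variable [LocallyCompactSpace G]

omit [CompactSpace G] [T2Space G] hp in
/-- **`H²(G, A)` is `p`-divisible** for a `p`-divisible discrete module over a group with
`cd_p(G) ≤ 2`: `H²(G, A) →(p) H²(G, A) → H³(G, A[p]) = 0`. [cite: SerreGaloisCohomology1997, I §3.1 Prop. 11]
[cite: MilneADT2006, I §3 (proof of Thm. 3.2)] -/
theorem exists_nsmul_eq_of_groupCdLE_two (hcd : GroupCdLE G p 2) (hdiv : ∀ a : A, ∃ b : A, p • b = a)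
    (x : continuousCohomology 2 τ.toTopRep) : ∃ y : continuousCohomology 2 τ.toTopRep, p • y = x := by
  haveI : Subsingleton (continuousCohomology 3 (τ.torsionRep p).toTopRep) :=
    hcd _ (τ.torsionRep p)
      (fun a => ⟨1, Subtype.ext (by
        rw [Submodule.coe_smul_of_tower, Submodule.coe_zero, pow_one]
        exact (ContinuousRep.mem_torsionBy_nsmul_iff p).1 a.2)⟩)
      (by norm_num)
  -- multiplication by `p` as an endomorphism of the discrete `G`-module `A`
  let g : τ.toTopRep ⟶ τ.toTopRep :=
    TopRep.ofHom
      { toLinearMap := (p : ℤ) • LinearMap.id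
        cont := continuous_of_discreteTopology
        isIntertwining' := fun σ => by
          ext a
          change (p : ℤ) • (τ σ a) = τ σ ((p : ℤ) • a)
          rw [map_zsmul] }
  have hg : ∀ a : A, g.hom a = p • a := fun a => by
    change (p : ℤ) • a = p • a
    rw [natCast_zsmul]
  obtain ⟨y, hy⟩ := (isSES_torsionIncl_of_hom τ g hg hdiv).exists_map_two_eq_of_subsingleton_three x
  refine ⟨y, ?_⟩
  rw [← hy]
  obtain ⟨c, rfl⟩ := twoCocycleClass_surjective _ y
  rw [cohomologyMap_twoCocycleClass]
  have e : contTwoCocycles.pullback (ContinuousMonoidHom.id G) (resIdHom g) c = p • c :=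
    Subtype.ext (ContinuousMap.ext fun q => by
      obtain ⟨σ, s⟩ := q
      rw [pullback₂_id_resIdHom_apply, hg]
      rfl)
  rw [e]
  exact (map_nsmul (twoCocycleClassₗ τ.toTopRep) p c).symm

omit [CompactSpace G] [T2Space G] hp in
/-- Iterate: `H²(G, A)` is `p^m`-divisible. [cite: MilneADT2006, I §3] -/
theorem exists_pow_nsmul_eq_of_groupCdLE_two (hcd : GroupCdLE G p 2) (hdiv : ∀ a : A, ∃ b : A, p • b = a)
    (m : ℕ) (x : continuousCohomology 2 τ.toTopRep) :
    ∃ y : continuousCohomology 2 τ.toTopRep, p ^ m • y = x := by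
  induction m generalizing x with
  | zero => exact ⟨x, by rw [pow_zero, one_smul]⟩
  | succ m ih =>
    obtain ⟨y, rfl⟩ := exists_nsmul_eq_of_groupCdLE_two τ hcd hdiv x
    obtain ⟨z, rfl⟩ := ih y
    exact ⟨z, by rw [pow_succ, mul_comm, mul_smul]⟩

omit [T2Space G] hp in
/-- **Every class of `H²(G, A)` comes from some `H²(G, A[p^k])`, and is then killed by `p^k`**: a
continuous `2`-cocycle on the compact group takes finitely many values in the `p`-primary module `A`.
[cite: Shatz1972, Ch. II §2 Prop. 6 (proof)] -/
theorem exists_mem_range_cohomologyMap_torsionIncl (hprim : IsPrimaryTorsion p A)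
    (x : continuousCohomology 2 τ.toTopRep) :
    ∃ k : ℕ, p ^ k • x = 0 ∧ ∃ y : continuousCohomology 2 (τ.torsionRep (p ^ k)).toTopRep,
      cohomologyMap (τ.torsionIncl (p ^ k)) 2 y = x := by
  obtain ⟨c, rfl⟩ := twoCocycleClass_surjective _ x
  obtain ⟨k, hk⟩ := IsPrimaryTorsion.continuousMap (X := G × G) hprim c.1
  have hmem : ∀ q : G × G, c.1 q ∈ Submodule.torsionBy ℤ A ((p ^ k : ℕ) : ℤ) := fun q => by
    rw [ContinuousRep.mem_torsionBy_nsmul_iff]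
    have h := congrArg (fun f : C(G × G, A) => f q) hk
    simpa only [ContinuousMap.smul_apply, ContinuousMap.zero_apply] using h
  let c' : contTwoCocycles (τ.torsionRep (p ^ k)).toTopRep :=
    ⟨⟨fun q => ⟨c.1 q, hmem q⟩, c.1.continuous.subtype_mk _⟩, fun σ s t =>
      Subtype.ext (c.2 σ s t)⟩
  have hc' : contTwoCocycles.pullback (ContinuousMonoidHom.id G) (resIdHom (τ.torsionIncl (p ^ k))) c' = c :=
    Subtype.ext (ContinuousMap.ext fun q => by
      obtain ⟨σ, s⟩ := q
      rw [pullback₂_id_resIdHom_apply]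
      rfl)
  refine ⟨k, ?_, twoCocycleClass _ c', by rw [cohomologyMap_twoCocycleClass, hc']⟩
  have h0 : p ^ k • c = 0 := Subtype.ext hk
  change p ^ k • twoCocycleClassₗ τ.toTopRep c = 0
  rw [← map_nsmul (twoCocycleClassₗ τ.toTopRep) (p ^ k) c, h0, map_zero]

omit [T2Space G] in
/-- **`H²(G, A) = 0` for a `p`-divisible `p`-primary discrete `G`-module with `cd_p(G) ≤ 2` and
`#H²(G, A[p^k])` uniformly bounded.** [cite: MilneADT2006, I §3 (Rem. 3.6, proof of Thm. 3.2)]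
[cite: SerreGaloisCohomology1997, II §5] -/
theorem subsingleton_two_of_divisible_of_natCard_le (hcd : GroupCdLE G p 2) (hprim : IsPrimaryTorsion p A)
    (hdiv : ∀ a : A, ∃ b : A, p • b = a) (B : ℕ)
    (hB : ∀ k : ℕ, Finite (continuousCohomology 2 (τ.torsionRep (p ^ k)).toTopRep) ∧
      Nat.card (continuousCohomology 2 (τ.torsionRep (p ^ k)).toTopRep) ≤ B) :
    Subsingleton (continuousCohomology 2 τ.toTopRep) := by
  refine ⟨fun x₁ x₂ => ?_⟩
  suffices h : ∀ x : continuousCohomology 2 τ.toTopRep, x = 0 by rw [h x₁, h x₂]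
  intro x
  -- `x = p^m y` with `p^m > B`
  obtain ⟨y, rfl⟩ := exists_pow_nsmul_eq_of_groupCdLE_two τ hcd hdiv B x
  -- `y` comes from some `H²(G, A[p^k])`, whose image has order `≤ B`
  obtain ⟨k, hky, z, hz⟩ := exists_mem_range_cohomologyMap_torsionIncl τ hprim y
  obtain ⟨hfin, hcard⟩ := hB k
  let φ : continuousCohomology 2 (τ.torsionRep (p ^ k)).toTopRep →+ continuousCohomology 2 τ.toTopRep :=
    (cohomologyMap (τ.torsionIncl (p ^ k)) 2).hom.toLinearMap.toAddMonoidHom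
  haveI : Finite φ.range := Finite.of_surjective _ (AddMonoidHom.rangeRestrict_surjective φ)
  have hrange : Nat.card φ.range ≤ B :=
    (Nat.card_le_card_of_surjective _ (AddMonoidHom.rangeRestrict_surjective φ)).trans hcard
  have hyr : y ∈ φ.range := ⟨z, hz⟩
  -- the order of `y` is a power of `p` bounded by `B < p^B`
  have hord : addOrderOf y ≤ B := by
    have h1 : addOrderOf (⟨y, hyr⟩ : φ.range) ≤ Nat.card φ.range :=
      Nat.le_of_dvd Nat.card_pos (addOrderOf_dvd_natCard _)
    rw [AddSubgroup.addOrderOf_mk] at h1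
    exact h1.trans hrange
  have hdvd : addOrderOf y ∣ p ^ k := addOrderOf_dvd_iff_nsmul_eq_zero.mpr hky
  obtain ⟨j, -, hj⟩ := (Nat.dvd_prime_pow hp.out).1 hdvd
  have hjB : j < B := by
    by_contra hle
    have hle' : B ≤ j := Nat.le_of_not_lt hle
    have h1 : p ^ B ≤ p ^ j := Nat.pow_le_pow_right hp.out.pos hle'
    have h2 : B < p ^ B := Nat.lt_pow_self hp.out.one_lt
    rw [hj] at hord
    omega
  have hdvd' : addOrderOf y ∣ p ^ B := by
    rw [hj]
    exact pow_dvd_pow p hjB.le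
  exact addOrderOf_dvd_iff_nsmul_eq_zero.mp hdvd'

end Literature.NumberTheory.GaloisRepresentations

end
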